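import Summits.ResolutionOfSingularities.ResolutionOfSingularities.Theorems.FrobeniusLadderFInjectiveMacaulayficationE7Char3FiModel
import HarnessLib

/-!
# Crux `FInjectiveMacaulayfication`: the chart clause (b′) of the point blow-up of the `E₇⁰`-type point
`X₂² + X₁X₀³ + X₁³` in characteristic 3, exported chart by chart (line `Sketch`, cycle 7)

Support file for crux `stmt-ResolutionOfSingularities-15315` (`FrobeniusLadder.FInjectiveMacaulayfication`, route
`ResolutionOfSingularities/FrobeniusLadder`, rung 2), line `Sketch`, registered stub `stub_e7Char3Charts` (lead
seat c6).

The E6′ recipe `BlowupFiModel.blowupFiModel_of_maximal` certifies a point blow-up `Bl_𝔪(Spec A)` stalk by stalk from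
two inputs: (a) the clause off the centre, and (b′) the clause at the maximal ideals `Q ∋ x̄ᵢ/1` of the chart rings
`A[𝔪/x̄ᵢ] = (A[𝔪t])_{(x̄ᵢt)}` (Cohen–Macaulay: every system of parameters of `A[𝔪/x̄ᵢ]_Q` is weakly regular; and
every parameter ideal is Frobenius closed, exponent base `3`). For `A = R' = k[X]/(g)`, `g = X₂² + X₁X₀³ + X₁³`
(the `E₇⁰`-type point met on the `y`-chart of the first blow-up of `E₈⁰` in characteristic `3`), input (b′) was
discharged INSIDE the proof of `E7Char3FiModel.e7Char3FiModel` (p145076) and never exported. The second step of the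
characteristic-3 tower runs on the NON-affine `Bl_𝔪 E₈⁰` and needs (b′) as a standalone statement (to be
transported along `ReesChartCongr`); this file extracts it verbatim:

* the `X₀`-chart is `k[X]/(h₀)`, `h₀ = X₂² + X₁X₀² + X₀X₁³` (`E7Forms.stub_e7Forms`, `StrictTransformChart` through
  `E7Char3FiModel.chart_clause_of_presentation`); its `D`-type origin passes Fedder's test and its other exceptional
  closed points are regular (`E7ChartX0Points.stub_e7ChartX0Points`);
* the `X₁`-chart is `k[X]/(h₁)`, `h₁ = X₂² + X₁ + X₀³X₁²`, regular along the exceptional divisor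
  (`E7ChartX1Points.stub_e7ChartX1Points`);
* the `X₂`-chart misses the exceptional divisor: `x̄₂/1` is a unit (`E7ChartX2Unit.stub_e7ChartX2Unit`), so no
  maximal ideal contains it.

* `stub_e7Char3Charts` — the registered form.

References: R. Fedder, Trans. AMS 278 (1983), Prop. 1.7, Thm. 1.12; The Stacks Project, Tag 0804. [folklore]
-/

-- single-problem summit: the doubled namespace component is forced
set_option linter.dupNamespace false

noncomputable section

namespace Summit.ResolutionOfSingularities.ResolutionOfSingularities.Theorems.FInjectiveMacaulayfication.E7Char3Charts

open AlgebraicGeometry CategoryTheory Literature.AlgebraicGeometry.Resolution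
open Summit.ResolutionOfSingularities.ResolutionOfSingularities.Theorems.FInjectiveMacaulayfication

/-- **The chart clause (b′) for the point blow-up of the `E₇⁰`-type point in characteristic 3** (registered stub
`stub_e7Char3Charts` of crux stmt-ResolutionOfSingularities-15315, line `Sketch`): for every field `k` of
characteristic `3`, `g = X₂² + X₁X₀³ + X₁³`, `R' = k[X]/(g)` with centre `𝔪' = (x̄₀, x̄₁, x̄₂)`, every chart index `i`
with `x̄ᵢ ≠ 0` and every maximal ideal `Q` of the chart ring `(R'[𝔪't])_{(x̄ᵢt)}` containing `x̄ᵢ/1`, the local ring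
at `Q` has every system of parameters weakly regular and every parameter ideal Frobenius closed — the second bullet
of `E7Char3FiModel.e7Char3FiModel`, chart by chart: `X₀`-chart by `E7ChartX0Points`, `X₁`-chart by
`E7ChartX1Points` (both through `E7Char3FiModel.chart_clause_of_presentation` and the forms `E7Forms.stub_e7Forms`),
`X₂`-chart vacuous by `E7ChartX2Unit`. [folklore] -/
theorem stub_e7Char3Charts : ∀ (k : Type) [Field k] [CharP k 3] (g : MvPolynomial (Fin 3) k),
    g = MvPolynomial.X 2 ^ 2 + MvPolynomial.X 1 * MvPolynomial.X 0 ^ 3 + MvPolynomial.X 1 ^ 3 →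
    ∀ (x : Fin 3 → MvPolynomial (Fin 3) k ⧸ Ideal.span {g}),
      x = (fun j : Fin 3 => Ideal.Quotient.mk (Ideal.span {g}) (MvPolynomial.X j)) →
      ∀ (i : Fin 3), x i ≠ 0 →
        ∀ (Q : Ideal (HomogeneousLocalization.Away (reesGrading (Ideal.span (Set.range x)))
            (reesT (x i) (Ideal.subset_span (Set.mem_range_self i))))) [Q.IsMaximal],
          reesChartBase (x i) (Ideal.subset_span (Set.mem_range_self i)) (x i) ∈ Q →
          ∀ d : ℕ, ringKrullDim (Localization.AtPrime Q) = d → ∀ s : Fin d → Localization.AtPrime Q,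
            (Ideal.span (Set.range s)).radical.IsMaximal →
              RingTheory.Sequence.IsWeaklyRegular (Localization.AtPrime Q) (List.ofFn s) ∧
              ∀ y : Localization.AtPrime Q, (∃ e : ℕ, y ^ 3 ^ e ∈ Ideal.span
                ((fun z : Localization.AtPrime Q => z ^ 3 ^ e) ''
                  (Ideal.span (Set.range s) : Set (Localization.AtPrime Q)))) → y ∈ Ideal.span (Set.range s) := by
  intro k _ _ g hg
  -- the forms: `g` prime and non-zero, the strict transforms `h0`, `h1` prime, the chart identities (every
  -- destructuring below is on a VARIABLE: `obtain … := <term>` would `generalize`, i.e. re-typecheck a goal that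
  -- mentions the chart rings, which does not fit in the heartbeat budget)
  have hforms : ∃ h0 h1 : MvPolynomial (Fin 3) k,
      h0 = MvPolynomial.X 2 ^ 2 + MvPolynomial.X 1 * MvPolynomial.X 0 ^ 2 + MvPolynomial.X 0 * MvPolynomial.X 1 ^ 3 ∧
      h1 = MvPolynomial.X 2 ^ 2 + MvPolynomial.X 1 + MvPolynomial.X 0 ^ 3 * MvPolynomial.X 1 ^ 2 :=
    ⟨_, _, rfl, rfl⟩
  obtain ⟨h0, h1, hh0, hh1⟩ := hforms
  have hforms := E7Forms.stub_e7Forms k g h0 h1 hg hh0 hh1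
  obtain ⟨⟨hgprime, hg0⟩, ⟨hh0prime, hX0h0, hθ0⟩, ⟨hh1prime, hX1h1, hθ1⟩⟩ := hforms
  -- chart by chart (the hypothesis `x̄ᵢ ≠ 0` is not needed: each chart is settled by its presentation)
  intro x hx i
  have hi : i = 0 ∨ i = 1 ∨ i = 2 := by
    revert i
    decide
  intro _
  rcases hi with rfl | rfl | rfl
  · -- the `X₀`-chart `k[X]/(h0)`: the `D`-type origin passes Fedder, the other exceptional closed points are regular
    intro Q hQ huQ
    have key := E7Char3FiModel.chart_clause_of_presentation 3 k g hgprime hg0 x hx 0 h0 2 hh0prime hX0h0 hθ0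
      (fun Q' _ hQ' => E7ChartX0Points.stub_e7ChartX0Points k h0 hh0 Q' hQ') Q huQ
    exact key
  · -- the `X₁`-chart `k[X]/(h1)`: regular along the exceptional divisor
    intro Q hQ huQ
    have key := E7Char3FiModel.chart_clause_of_presentation 3 k g hgprime hg0 x hx 1 h1 2 hh1prime hX1h1 hθ1
      (fun Q' _ hQ' => E7ChartX1Points.stub_e7ChartX1Points k h1 hh1 Q' hQ') Q huQ
    exact key
  · -- the `X₂`-chart misses the exceptional divisor: `x̄₂/1` is a unit
    intro Q hQ huQ
    have hunit := E7ChartX2Unit.stub_e7ChartX2Unit k g hg x hx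
    exact absurd (Ideal.eq_top_of_isUnit_mem Q huQ hunit) hQ.ne_top

end Summit.ResolutionOfSingularities.ResolutionOfSingularities.Theorems.FInjectiveMacaulayfication.E7Char3Charts

end
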